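import Mathlib
import Summits.NavierStokesRegularity.NavierStokesRegularity.Theorems.ThreadingFluxHorizonTowerFiniteTowerByName
import Summits.NavierStokesRegularity.NavierStokesRegularity.Theorems.ThreadingFluxHorizonTowerTwoShellBracketByName
import HarnessLib

/-!
# Crux `PoloidalLiouville` (stmt-NavierStokesRegularity-1222), crux idea «horizon-threading-tower» (ns-idea-15):
# FINITE TOWERS AT ORDER ONE — SINGLETON PARITY CLASSES and ★★ ALL MIXED-PARITY THREE-SHELL TOWERS

Support file (`--supports stmt-NavierStokesRegularity-1222`, helper; cell `ns-wall-extremal`, width hand ns-wall-eng-3 g4; 0 kit).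

* `finiteTower_bracket_eq_zero_of_singleton_class` — in a finite scale-free tower passing order one, a pair of degrees `{j₀, k₀}` that
  is ALONE in its parity class of `j + k` (every other pair of distinct degrees of that class has vanishing bracket) has vanishing
  bracket `⟪x, ∇H_{j₀} × ∇H_{k₀}⟫ ≡ 0` on ALL of `ℝ³` (`finiteTower_parity_split`, p695631; the weights `λ_j − λ_k` and `‖x‖^{−j−k}`
  never vanish off the centre) — the full-space companion of the null-cone ISOLATION LEMMA of `…FiniteTowerIsolation`.
* ★★ `threeShell_zonal_of_mixedParity` / `threeShell_zonalForm_of_mixedParity` — EVERY THREE-SHELL TOWER `{l, m, n}` (distinct degrees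
  `≥ 1`, all three shells `≢ 0`) WHOSE DEGREES ARE NOT ALL OF ONE PARITY is coaxially zonal at order one.  The pair of equal parity is
  alone in the even class, so its bracket vanishes on `ℝ³`; the two-shell theorem (`twoShellBracketZonality`, p691694) makes it coaxially
  zonal; that pair always contains the top degree `n` (⇒ THM A `finiteTower_zonal_of_zonalTop`) or is `{l, m}` (⇒ THM A′
  `finiteTower_zonal_of_zonalSecond`).  This generalises ARM A's `dipoleTowerHorizonZonality` (`{1, m, n}`, `m, n` not both odd,
  p701741 — cited, not restated) to an arbitrary lowest degree `l`, and needs no coprimality.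

HONEST LABEL: special cases of the crux-idea conjecture `HorizonTowerZonality` (three shells of mixed parity, order one); the all-odd /
all-even three-shell towers with non-coprime top pair (e.g. `{2,4,6}`, `{1,3,9}`), general finite towers, general towers,
`PoloidalLiouville` (1222), `UnthreadedRigidity` (27585) OPEN; W1 movement 0; NS regularity NOT proved.  [folklore]
-/

-- the summit and its single sub-problem share the name (CONVENTIONS §1)
set_option linter.dupNamespace false

noncomputable section

open scoped RealInnerProductSpace
open Literature.Analysis.FluidPDE (cross)

namespace Summit.NavierStokesRegularity.NavierStokesRegularity.Theorems.PoloidalLiouville.HorizonTower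

section SingletonClass

variable (K : Finset ℕ) (H : ℕ → E3 → ℝ)

/-- **SINGLETON PARITY CLASS ⇒ THE BRACKET VANISHES ON ℝ³.**  In a finite scale-free tower passing order one, if every pair of distinct
degrees `{j, k} ≠ {j₀, k₀}` with `j + k ≡ j₀ + k₀ (mod 2)` has vanishing bracket, then so does the pair `{j₀, k₀}`. [folklore] -/
theorem finiteTower_bracket_eq_zero_of_singleton_class (hK : ∀ l ∈ K, 1 ≤ l) (hH : ∀ l ∈ K, ContDiff ℝ (⊤ : ℕ∞) (H l))
    (hhom : ∀ l ∈ K, ∀ (c : ℝ) (y : E3), H l (c • y) = c ^ l * H l y)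
    (hharm : ∀ l ∈ K, ∀ y, Laplacian.laplacian (H l) y = 0)
    (hL1 : ∀ x : E3, x ≠ 0 → horizonL1 (fun z => ∑ l ∈ K, horizonProfile l (H l) 0 z) 0 x = 0)
    {j₀ k₀ : ℕ} (hj₀ : j₀ ∈ K) (hk₀ : k₀ ∈ K) (hjk : j₀ ≠ k₀)
    (halone : ∀ j ∈ K, ∀ k ∈ K, j ≠ k → (j + k) % 2 = (j₀ + k₀) % 2 → ¬(j = j₀ ∧ k = k₀) → ¬(j = k₀ ∧ k = j₀) →
      ∀ x : E3, ⟪x, cross (gradient (H j) x) (gradient (H k) x)⟫ = 0) (x : E3) :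
    ⟪x, cross (gradient (H j₀) x) (gradient (H k₀) x)⟫ = 0 := by
  classical
  by_cases hx : x = 0
  · rw [hx, inner_zero_left]
  obtain ⟨hE, hO⟩ := finiteTower_parity_split K H hK hH hhom hharm hL1 hx
  set w : ℕ → ℕ → ℝ := fun j k =>
    (((j * (j + 1) : ℝ)) - (k * (k + 1) : ℝ)) * (‖x‖ ^ 2) ^ (-(j : ℝ) / 2) * (‖x‖ ^ 2) ^ (-(k : ℝ) / 2) with hw
  set B : ℕ → ℕ → ℝ := fun j k => ⟪x, cross (gradient (H j) x) (gradient (H k) x)⟫ with hB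
  -- the class sum of the parity of `j₀ + k₀`, in a uniform shape
  have hS : ∑ j ∈ K, ∑ k ∈ K, (if (j + k) % 2 = (j₀ + k₀) % 2 then w j k * B j k else 0) = 0 := by
    rcases Nat.even_or_odd (j₀ + k₀) with he | ho
    · have h0 : (j₀ + k₀) % 2 = 0 := Nat.even_iff.mp he
      refine Eq.trans (Finset.sum_congr rfl fun j _ => Finset.sum_congr rfl fun k _ => ?_) hE
      rw [h0]
      by_cases hjk2 : Even (j + k)
      · rw [if_pos (Nat.even_iff.mp hjk2), if_pos hjk2]
      · rw [if_neg (by rw [Nat.even_iff] at hjk2; exact hjk2), if_neg hjk2]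
    · have h1 : (j₀ + k₀) % 2 = 1 := Nat.odd_iff.mp ho
      refine Eq.trans (Finset.sum_congr rfl fun j _ => Finset.sum_congr rfl fun k _ => ?_) hO
      rw [h1]
      by_cases hjk2 : Even (j + k)
      · rw [if_neg (by rw [Nat.even_iff.mp hjk2]; decide), if_pos hjk2]
      · rw [if_pos (Nat.odd_iff.mp (Nat.not_even_iff_odd.mp hjk2)), if_neg hjk2]
  -- antisymmetry of the bracket
  have hanti : ∀ j k, B k j = -B j k := by
    intro j k
    simp only [hB]
    obtain ⟨p0, p1, p2⟩ := cross_fin3 (gradient (H k) x) (gradient (H j) x)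
    obtain ⟨q0, q1, q2⟩ := cross_fin3 (gradient (H j) x) (gradient (H k) x)
    rw [Literature.Geometry.DiscreteGeometry.inner_fin3, Literature.Geometry.DiscreteGeometry.inner_fin3, p0, p1, p2, q0, q1, q2]
    ring
  -- only the two orderings of the pair survive
  rw [← Finset.sum_product' K K (fun j k => if (j + k) % 2 = (j₀ + k₀) % 2 then w j k * B j k else 0)] at hS
  rw [Finset.sum_eq_add_of_mem (j₀, k₀) (k₀, j₀) (Finset.mk_mem_product hj₀ hk₀) (Finset.mk_mem_product hk₀ hj₀)
      (by simp [Prod.ext_iff, hjk]) ?_] at hS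
  · simp only [show (k₀ + j₀) % 2 = (j₀ + k₀) % 2 by rw [add_comm], if_true, hanti j₀ k₀] at hS
    -- `hS : w j₀ k₀ * B + w k₀ j₀ * (−B) = 0`, and `w k₀ j₀ = −w j₀ k₀` up to the positive radial weights
    have hr : 0 < ‖x‖ ^ 2 := by positivity
    have hρa : 0 < (‖x‖ ^ 2) ^ (-(j₀ : ℝ) / 2) := Real.rpow_pos_of_pos hr _
    have hρb : 0 < (‖x‖ ^ 2) ^ (-(k₀ : ℝ) / 2) := Real.rpow_pos_of_pos hr _
    have hlam : ((j₀ * (j₀ + 1) : ℝ) - k₀ * (k₀ + 1)) ≠ 0 := mul_succ_ne_of_ne hjk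
    have hkey : 2 * (((j₀ * (j₀ + 1) : ℝ) - k₀ * (k₀ + 1)) * (‖x‖ ^ 2) ^ (-(j₀ : ℝ) / 2) * (‖x‖ ^ 2) ^ (-(k₀ : ℝ) / 2))
        * B j₀ k₀ = 0 := by
      simp only [hw] at hS
      linear_combination hS
    have hc : 2 * (((j₀ * (j₀ + 1) : ℝ) - k₀ * (k₀ + 1)) * (‖x‖ ^ 2) ^ (-(j₀ : ℝ) / 2) * (‖x‖ ^ 2) ^ (-(k₀ : ℝ) / 2)) ≠ 0 :=
      mul_ne_zero two_ne_zero (mul_ne_zero (mul_ne_zero hlam hρa.ne') hρb.ne')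
    exact (mul_eq_zero.mp hkey).resolve_left hc
  · rintro ⟨j, k⟩ hjk' ⟨hne1, hne2⟩
    obtain ⟨hj, hk⟩ := Finset.mem_product.mp hjk'
    simp only at hj hk ⊢
    by_cases hpar : (j + k) % 2 = (j₀ + k₀) % 2
    · rw [if_pos hpar]
      by_cases hjk2 : j = k
      · subst hjk2
        have : B j j = 0 := by have := hanti j j; linarith
        rw [this, mul_zero]
      · rw [show B j k = 0 from halone j hj k hk hjk2 hpar (fun h => hne1 (Prod.ext h.1 h.2))
          (fun h => hne2 (Prod.ext h.1 h.2)) x, mul_zero]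
    · rw [if_neg hpar]

end SingletonClass

/-! ### ★★ Three-shell towers of mixed parity -/

section ThreeShell

/-- The three-shell tower as a finite tower over `K = {l, m, n}`. [folklore] -/
theorem threeShell_sum_eq {l m n : ℕ} (hlm : l ≠ m) (hln : l ≠ n) (hmn : m ≠ n) (A B C : E3 → ℝ) (z : E3) :
    ∑ k ∈ ({l, m, n} : Finset ℕ), horizonProfile k ((fun k => if k = n then C else if k = m then B else A) k) 0 z
      = horizonProfile l A 0 z + horizonProfile m B 0 z + horizonProfile n C 0 z := by
  rw [Finset.sum_insert (by simp [hlm, hln]), Finset.sum_insert (by simp [hmn]), Finset.sum_singleton]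
  simp [hlm, hln, hmn, add_assoc]

/-- ★★ **EVERY MIXED-PARITY THREE-SHELL TOWER IS DECIDED AT ORDER ONE.**  Let `l < m < n` be degrees `≥ 1`, NOT all of the same parity,
and `A ∈ 𝓗_l`, `B ∈ 𝓗_m`, `C ∈ 𝓗_n` smooth homogeneous harmonic shells, all `≢ 0`.  If the scale-free tower `U_A + U_B + U_C` is
annihilated by the order-one horizon law off the centre, then the three shells are zonal about ONE common axis `a ≠ 0`
(`⟪a × y, ∇·⟫ ≡ 0`).  (Generalises `dipoleTowerHorizonZonality`, `l = 1`.) [folklore] -/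
theorem threeShell_zonal_of_mixedParity {l m n : ℕ} (hl : 1 ≤ l) (hlm : l < m) (hmn : m < n)
    (hpar : ¬(l % 2 = m % 2 ∧ m % 2 = n % 2)) {A B C : E3 → ℝ}
    (hA : ContDiff ℝ (⊤ : ℕ∞) A) (hhomA : ∀ (c : ℝ) (y : E3), A (c • y) = c ^ l * A y) (hharmA : ∀ y, Laplacian.laplacian A y = 0)
    (hB : ContDiff ℝ (⊤ : ℕ∞) B) (hhomB : ∀ (c : ℝ) (y : E3), B (c • y) = c ^ m * B y) (hharmB : ∀ y, Laplacian.laplacian B y = 0)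
    (hC : ContDiff ℝ (⊤ : ℕ∞) C) (hhomC : ∀ (c : ℝ) (y : E3), C (c • y) = c ^ n * C y) (hharmC : ∀ y, Laplacian.laplacian C y = 0)
    (hA0 : ∃ y, A y ≠ 0) (hB0 : ∃ y, B y ≠ 0) (hC0 : ∃ y, C y ≠ 0)
    (hL1 : ∀ x : E3, x ≠ 0 → horizonL1 (fun z => horizonProfile l A 0 z + horizonProfile m B 0 z + horizonProfile n C 0 z) 0 x = 0) :
    ∃ a : E3, a ≠ 0 ∧ (∀ y : E3, ⟪cross a y, gradient A y⟫ = 0) ∧ (∀ y : E3, ⟪cross a y, gradient B y⟫ = 0) ∧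
      (∀ y : E3, ⟪cross a y, gradient C y⟫ = 0) := by
  classical
  have hln : l < n := hlm.trans hmn
  have hm : 1 ≤ m := by omega
  have hn : 1 ≤ n := by omega
  -- the tower over `K = {l, m, n}`
  set K : Finset ℕ := {l, m, n} with hKdef
  set Hs : ℕ → E3 → ℝ := fun k => if k = n then C else if k = m then B else A with hHs
  have hHl : Hs l = A := by simp [hHs, hln.ne, hlm.ne]
  have hHm : Hs m = B := by simp [hHs, hmn.ne]
  have hHn : Hs n = C := by simp [hHs]
  have hmem : ∀ k ∈ K, k = l ∨ k = m ∨ k = n := fun k hk => by simpa [hKdef] using hk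
  have hlK : l ∈ K := by simp [hKdef]
  have hmK : m ∈ K := by simp [hKdef]
  have hnK : n ∈ K := by simp [hKdef]
  have hK1 : ∀ k ∈ K, 1 ≤ k := by intro k hk; rcases hmem k hk with rfl | rfl | rfl <;> assumption
  have hHs' : ∀ k ∈ K, ContDiff ℝ (⊤ : ℕ∞) (Hs k) := by
    intro k hk; rcases hmem k hk with rfl | rfl | rfl
    · rw [hHl]; exact hA
    · rw [hHm]; exact hB
    · rw [hHn]; exact hC
  have hhom' : ∀ k ∈ K, ∀ (c : ℝ) (y : E3), Hs k (c • y) = c ^ k * Hs k y := by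
    intro k hk; rcases hmem k hk with rfl | rfl | rfl
    · rw [hHl]; exact hhomA
    · rw [hHm]; exact hhomB
    · rw [hHn]; exact hhomC
  have hharm' : ∀ k ∈ K, ∀ y, Laplacian.laplacian (Hs k) y = 0 := by
    intro k hk; rcases hmem k hk with rfl | rfl | rfl
    · rw [hHl]; exact hharmA
    · rw [hHm]; exact hharmB
    · rw [hHn]; exact hharmC
  have hL1' : ∀ x : E3, x ≠ 0 → horizonL1 (fun z => ∑ k ∈ K, horizonProfile k (Hs k) 0 z) 0 x = 0 := by
    intro x hx
    have hfun : (fun z => ∑ k ∈ K, horizonProfile k (Hs k) 0 z)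
        = fun z => horizonProfile l A 0 z + horizonProfile m B 0 z + horizonProfile n C 0 z :=
      funext fun z => threeShell_sum_eq hlm.ne hln.ne hmn.ne A B C z
    rw [hfun]; exact hL1 x hx
  have hmax : ∀ k ∈ K, k ≤ n := by intro k hk; rcases hmem k hk with rfl | rfl | rfl <;> omega
  have hsec : ∀ k ∈ K, k ≠ n → k ≤ m := by
    intro k hk hkn; rcases hmem k hk with rfl | rfl | rfl <;> omega
  have hC0' : ∃ y, Hs n y ≠ 0 := by rw [hHn]; exact hC0
  have hB0' : ∃ y, Hs m y ≠ 0 := by rw [hHm]; exact hB0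
  -- a singleton class gives a vanishing bracket on ℝ³; the two-shell theorem gives a common axis
  have key : ∀ {j k : ℕ}, j ∈ K → k ∈ K → j < k →
      (∀ j' ∈ K, ∀ k' ∈ K, j' ≠ k' → (j' + k') % 2 = (j + k) % 2 → ¬(j' = j ∧ k' = k) → ¬(j' = k ∧ k' = j) → False) →
      ∃ a : E3, a ≠ 0 ∧ (∀ y : E3, ⟪cross a y, gradient (Hs j) y⟫ = 0) ∧ (∀ y : E3, ⟪cross a y, gradient (Hs k) y⟫ = 0) := by
    intro j k hj hk hjk halone
    have hbr : ∀ x : E3, ⟪x, cross (gradient (Hs j) x) (gradient (Hs k) x)⟫ = 0 :=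
      finiteTower_bracket_eq_zero_of_singleton_class K Hs hK1 hHs' hhom' hharm' hL1' hj hk hjk.ne
        (fun j' hj' k' hk' hne hp h1 h2 => absurd (halone j' hj' k' hk' hne hp h1 h2) id)
    have hj0 : ∃ y, Hs j y ≠ 0 := by
      rcases hmem j hj with rfl | rfl | rfl
      · rw [hHl]; exact hA0
      · rw [hHm]; exact hB0
      · rw [hHn]; exact hC0
    have hk0 : ∃ y, Hs k y ≠ 0 := by
      rcases hmem k hk with rfl | rfl | rfl
      · rw [hHl]; exact hA0
      · rw [hHm]; exact hB0
      · rw [hHn]; exact hC0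
    obtain ⟨a, gj, gk, ha, hgj, hgk⟩ := twoShellBracketZonality j k (Hs j) (Hs k) (hK1 j hj) (hK1 k hk) hjk.ne (hHs' j hj)
      (hhom' j hj) (hharm' j hj) (hHs' k hk) (hhom' k hk) (hharm' k hk) hj0 hk0 hbr
    exact ⟨a, ha,
      inner_cross_gradient_eq_zero_of_zonalForm (l := j) ha ((hHs' j hj).differentiable (by simp)) hgj,
      inner_cross_gradient_eq_zero_of_zonalForm (l := k) ha ((hHs' k hk).differentiable (by simp)) hgk⟩
  -- conclude from an axis for ALL shells of the tower `Hs`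
  have finish : ∀ {a : E3}, a ≠ 0 → (∀ k ∈ K, ∀ y : E3, ⟪cross a y, gradient (Hs k) y⟫ = 0) →
      ∃ a : E3, a ≠ 0 ∧ (∀ y : E3, ⟪cross a y, gradient A y⟫ = 0) ∧ (∀ y : E3, ⟪cross a y, gradient B y⟫ = 0) ∧
        (∀ y : E3, ⟪cross a y, gradient C y⟫ = 0) := by
    intro a ha hall
    refine ⟨a, ha, ?_, ?_, ?_⟩
    · have := hall l hlK; rwa [hHl] at this
    · have := hall m hmK; rwa [hHm] at this
    · have := hall n hnK; rwa [hHn] at this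
  -- which shell is the odd one out?
  by_cases hmn2 : m % 2 = n % 2
  · -- `l` is the odd one out: the pair `{m, n}` is alone in its class ⇒ top shell zonal ⇒ THM A
    have hl2 : l % 2 ≠ m % 2 := fun h => hpar ⟨h, hmn2⟩
    obtain ⟨a, ha, -, hCa⟩ := key hmK hnK hmn (by
      intro j' hj' k' hk' hne hp h1 h2
      rcases hmem j' hj' with rfl | rfl | rfl <;> rcases hmem k' hk' with rfl | rfl | rfl <;>
        first | exact hne rfl | exact h1 ⟨rfl, rfl⟩ | exact h2 ⟨rfl, rfl⟩ | omega)
    exact finish ha (finiteTower_zonal_of_zonalTop K Hs hK1 hHs' hhom' hharm' hL1' hnK hmax hC0' ha hCa)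
  · by_cases hlm2 : l % 2 = m % 2
    · -- `n` is the odd one out: `{l, m}` alone ⇒ second shell zonal ⇒ THM A′
      obtain ⟨a, ha, -, hBa⟩ := key hlK hmK hlm (by
        intro j' hj' k' hk' hne hp h1 h2
        rcases hmem j' hj' with rfl | rfl | rfl <;> rcases hmem k' hk' with rfl | rfl | rfl <;>
          first | exact hne rfl | exact h1 ⟨rfl, rfl⟩ | exact h2 ⟨rfl, rfl⟩ | omega)
      exact finish ha (finiteTower_zonal_of_zonalSecond K Hs hK1 hHs' hhom' hharm' hL1' hnK hmK hmn hmax hsec hC0' hB0' ha hBa)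
    · -- `m` is the odd one out: `{l, n}` alone ⇒ top shell zonal ⇒ THM A
      have hln2 : l % 2 = n % 2 := by omega
      obtain ⟨a, ha, -, hCa⟩ := key hlK hnK hln (by
        intro j' hj' k' hk' hne hp h1 h2
        rcases hmem j' hj' with rfl | rfl | rfl <;> rcases hmem k' hk' with rfl | rfl | rfl <;>
          first | exact hne rfl | exact h1 ⟨rfl, rfl⟩ | exact h2 ⟨rfl, rfl⟩ | omega)
      exact finish ha (finiteTower_zonal_of_zonalTop K Hs hK1 hHs' hhom' hharm' hL1' hnK hmax hC0' ha hCa)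

/-- The same with the ZONAL FUNCTIONAL FORMS of the Defs twin (shape of `DipoleTowerHorizonZonality`'s conclusion). [folklore] -/
theorem threeShell_zonalForm_of_mixedParity {l m n : ℕ} (hl : 1 ≤ l) (hlm : l < m) (hmn : m < n)
    (hpar : ¬(l % 2 = m % 2 ∧ m % 2 = n % 2)) {A B C : E3 → ℝ}
    (hA : ContDiff ℝ (⊤ : ℕ∞) A) (hhomA : ∀ (c : ℝ) (y : E3), A (c • y) = c ^ l * A y) (hharmA : ∀ y, Laplacian.laplacian A y = 0)
    (hB : ContDiff ℝ (⊤ : ℕ∞) B) (hhomB : ∀ (c : ℝ) (y : E3), B (c • y) = c ^ m * B y) (hharmB : ∀ y, Laplacian.laplacian B y = 0)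
    (hC : ContDiff ℝ (⊤ : ℕ∞) C) (hhomC : ∀ (c : ℝ) (y : E3), C (c • y) = c ^ n * C y) (hharmC : ∀ y, Laplacian.laplacian C y = 0)
    (hA0 : ∃ y, A y ≠ 0) (hB0 : ∃ y, B y ≠ 0) (hC0 : ∃ y, C y ≠ 0)
    (hL1 : ∀ x : E3, x ≠ 0 → horizonL1 (fun z => horizonProfile l A 0 z + horizonProfile m B 0 z + horizonProfile n C 0 z) 0 x = 0) :
    ∃ (a : E3) (gA gB gC : ℝ → ℝ), a ≠ 0 ∧
      (∀ y : E3, y ≠ 0 → A y = ‖y‖ ^ l * gA (⟪a, y⟫ / ‖y‖)) ∧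
      (∀ y : E3, y ≠ 0 → B y = ‖y‖ ^ m * gB (⟪a, y⟫ / ‖y‖)) ∧
      (∀ y : E3, y ≠ 0 → C y = ‖y‖ ^ n * gC (⟪a, y⟫ / ‖y‖)) := by
  obtain ⟨a, ha, hAa, hBa, hCa⟩ := threeShell_zonal_of_mixedParity hl hlm hmn hpar hA hhomA hharmA hB hhomB hharmB hC hhomC
    hharmC hA0 hB0 hC0 hL1
  obtain ⟨gA, hgA⟩ := exists_zonalForm_of_inner_cross_gradient_eq_zero (l := l) ha (hA.differentiable (by simp))
    (fun c y _ => hhomA c y) hAa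
  obtain ⟨gB, hgB⟩ := exists_zonalForm_of_inner_cross_gradient_eq_zero (l := m) ha (hB.differentiable (by simp))
    (fun c y _ => hhomB c y) hBa
  obtain ⟨gC, hgC⟩ := exists_zonalForm_of_inner_cross_gradient_eq_zero (l := n) ha (hC.differentiable (by simp))
    (fun c y _ => hhomC c y) hCa
  exact ⟨a, gA, gB, gC, ha, hgA, hgB, hgC⟩

end ThreeShell

end Summit.NavierStokesRegularity.NavierStokesRegularity.Theorems.PoloidalLiouville.HorizonTower

end
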